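import Summits.BirchSwinnertonDyer.BirchSwinnertonDyer.Theorems.PrintCf2SplitBadTwoLocalPointImageAlgebra
import Summits.BirchSwinnertonDyer.BirchSwinnertonDyer.Theorems.PrintCf2SplitBadTwoCMScalarAtVTorsion
import Summits.BirchSwinnertonDyer.BirchSwinnertonDyer.Theorems.PrintCf2SplitBadTwoLocalPointIndexBridge
import Summits.BirchSwinnertonDyer.BirchSwinnertonDyer.Theorems.PrintCf2SplitBadTwoMordellWeilCMFrame
import HarnessLib

/-!
# Crux `PrintCf2.SplitBadTwoRankOneOfFacts` (stmt-BirchSwinnertonDyer-20368), road α v10.3, S3c residual (F3), plain road, leaf (PI), file 2/2: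
# THE `𝒪_K`-COMBINATION AT `v` — `im(E(K) → E(K_v)) + 2^N E(K_v) = ℤ·P_v + E(K_v)[2] + 2^N E(K_v)` — AND **(PI) VERBATIM**: `v₂ [E(K_v) : im E(K) + 2^N E(K_v)] = ℓ`

Cell `bsd-print-cf2`, EXTRA WIDTH seat `bsd-line-cf2-p1-w6` g4 (prover-bsd-line-cf2-p1-w6-g4-0); LEAD cf2-p1 g13 ASSIGN 2026-08-28T23:58:11Z;
`--supports stmt-BirchSwinnertonDyer-20368` (helper, Theses-free). HONEST FRAMING: nothing here closes the crux or a registered stub; BSD is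
not proved by any of this; no summit statement is proved by this seat. No definition, no named fact, no `sorry`, no kit. beyond-print theorem: no.

WHAT (`G := ((W.baseChange K).baseChange (v.adicCompletion K)).toAffine.Point`, `P_v` = the frame's ℚ-generator read in `K_v` in -w2 g11's currency
`Affine.Point.baseChange K K_v (congrEquiv h₁ (map (ofId ℚ K) P))`):
* §3 `range_baseChange_sup_range_eq_of_discrepancy` — for ANY `K`-field `E`, the combination `im(E(K) → G) + 2^N G = ℤ·P_E + G[2] + 2^N G` for
  `N ≥ k₀`, from file 1's `range_sup_range_eq_of_inputs` with (1) -w6 g3 `MordellWeilCM.seven_smul_mem_of_frame` (`7·E(K) ⊆ ℤP_K + ℤπP_K + tors`),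
  (2) file 1's no-4-torsion, (4) file 1's `G[2] ⊆ im E(K)`, and (3) the DISPLAYED 2-torsion discrepancy «`f Q − N•Q − 2^k•R ∈ G[2]`, `N ≡ 1 − r`»;
* §4 **`range_baseChange_sup_range_eq_of_frame`** — at `E = K_v` the discrepancy is -w3 g10's `CMPrimes.cmScalar_pointHom_two_torsion_of_frame`
  (p681283; `φ` from `CMPrimes.exists_isogeny_apply_eq_cmEndo`, `f` from `exists_pointHom_localPointsMap`), so the combination holds on every S3c
  frame; `natCard_torsionBy_two_eq_four_of_frame` (`G[2] ⊆ im E(K)`, `#G[2] = 4`); and **`hPI_holds` = hypothesis `hPI` of -w8 g3's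
  `SelmerLocImage.hcounts_of_pointIndex_of_pinning_of_finiteSha` VERBATIM** (`e₃ ≡ 0`): the subgroup is `ℤ·P_v + G[2] + 2^N G`, whose index is
  `2^{ℓ}` by -w2 g11's `LocalLineCount.index_zmultiples_baseChange_sup_sup_range_eq` (p680004) with `C_t := G[2]`; `K_v ≅ ℚ₂` by -w6 g3's
  `exists_surjective_padic_adicCompletion`; `ℓ ≥ 0` by `DyadicTorsion.le_ell_of_smul_eq_quadraticTwist`; `h₁`, `h₂` by `WeierstrassCurve.map_baseChange` /
  `map_map`.
With -w6 g4's `CMPrimes.finite_sha_two_primary_baseChange_of_frame` (p679960) = `hShaFin` VERBATIM, the plain road now waits on (PIN) alone.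

References: [Rubin1999] §2–§3 (Lemma 3.6 (ii)); [Agboola2007] §6 Props. 6.10–6.11; [SilvermanAEC2009] Prop. VII.6.3, VIII §1; [GrossLMS1991] §5.
-/

noncomputable section

open scoped Classical

set_option linter.dupNamespace false
set_option autoImplicit false

open NumberField IsDedekindDomain Field WeierstrassCurve
open Literature.NumberTheory.EllipticCurves Literature.NumberTheory.EllipticCurves.GreenbergSelmer
open Literature.NumberTheory.EllipticCurves.Agboola2007
open Literature.NumberTheory.GaloisRepresentations

namespace Summit.BirchSwinnertonDyer.BirchSwinnertonDyer.Theorems.PrintCf2.LocalPointImage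

open Summit.BirchSwinnertonDyer.BirchSwinnertonDyer.Theorems.PrintCf2.RestrictedSelmerPair
open Summit.BirchSwinnertonDyer.BirchSwinnertonDyer.Theorems.PrintCf2.AdditiveAtSeven
open Summit.BirchSwinnertonDyer.BirchSwinnertonDyer.Theorems.PrintCf2.CMPrimes
open Summit.BirchSwinnertonDyer.BirchSwinnertonDyer.Theorems.PrintCf2.MordellWeilCM

section Frame

variable {K : Type} [Field K] [NumberField K]

/-! ## §3. The `𝒪_K`-combination on the frame, modulo the displayed 2-torsion discrepancy -/

/-- **THE `𝒪_K`-COMBINATION AT `v` modulo the discrepancy.** On an S3c frame (`C • W = cm7^{(d)}`, `d ≠ 0` squarefree, `d ≢ 1 (4)`; `K` imaginary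
quadratic, `2 = v·v̄`; `π² = π − 2`, `r² = r − 2`, pinning clause at `v`; `P ∈ W(ℚ)` of infinite order generating `W(ℚ)` mod torsion), for ANY `K`-field
`E` (`G := ((W_K) ⊗ E)(E)`), the isogeny `φ` realising `π` and any descended `f : G → G` (`ψ ∘ f = φ_E ∘ ψ`), GRANTED the 2-torsion discrepancy
«`f Q − N • Q − 2^k • R ∈ G[2]` for `N ≡ 1 − r (2^k)`, `k ≥ k₀`» (the conclusion of -w3 g10's `cmScalar_pointHom_two_torsion_of_frame`): for all
`N ≥ k₀`, **`im(E(K) → G) + 2^N G = ℤ·P_E + G[2] + 2^N G`** (`P_E` = `P` read in `E`, -w2 g11's currency).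
[cite: Rubin1999, §2–§3, Lemma 3.6 (ii)] [cite: Agboola2007, §6 Props. 6.10–6.11] [cite: SilvermanAEC2009, Prop. VII.6.3, VIII §1] -/
theorem range_baseChange_sup_range_eq_of_discrepancy {d : ℤ} (hd0 : d ≠ 0) (hsq : Squarefree d) (hd4 : d % 4 ≠ 1)
    (W : WeierstrassCurve ℚ) [W.IsElliptic] (C : VariableChange ℚ) (hC : C • W = cm7.quadraticTwist (d : ℚ)) (hK : IsImaginaryQuadratic K)
    (v vbar : HeightOneSpectrum (𝓞 K)) (hv : ((2 : ℕ) : 𝓞 K) ∈ v.asIdeal) (hvbar : ((2 : ℕ) : 𝓞 K) ∈ vbar.asIdeal) (hne : vbar ≠ v)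
    (π : (W.baseChange K).endRing) (hrel : (π : AddMonoid.End (W.baseChange K).geomPoints) * π = π - 2) {r : ℤ_[2]} (hr : r * r = r - 2)
    (hpin : ∀ τ ∈ GreenbergSelmer.inertia v, ∀ x : ↥((W.baseChange K).endEigenPrimaryTorsion 2 π r), τ • x = x ∨ τ • x = -x)
    {P : W.toAffine.Point} (hP : ¬ IsOfFinAddOrder P)
    (hgen : ∀ R : W.toAffine.Point, ∃ (k : ℤ) (T : W.toAffine.Point), IsOfFinAddOrder T ∧ R = k • P + T)
    (E : Type) [Field E] [Algebra K E] (h₁ : W.baseChange K = (W.baseChange K).baseChange K)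
    (φ : Isogeny (W.baseChange K) (W.baseChange K)) (hφ : ∀ Q, φ Q = (π : AddMonoid.End (W.baseChange K).geomPoints) Q)
    (f : ((W.baseChange K).baseChange E).toAffine.Point →+ ((W.baseChange K).baseChange E).toAffine.Point)
    (hf : ∀ Q, Affine.Point.map (W' := W.baseChange K) (IsScalarTower.toAlgHom K E (AlgebraicClosure E)) (f Q) =
      φ.localPointsMap E (Affine.Point.map (W' := W.baseChange K) (IsScalarTower.toAlgHom K E (AlgebraicClosure E)) Q))
    (hdisc : ∃ k₀ : ℕ, ∀ k : ℕ, k₀ ≤ k → ∀ N : ℤ, ((N : ℤ_[2]) - (1 - r)) ∈ (Ideal.span {(2 : ℤ_[2]) ^ k} : Ideal ℤ_[2]) →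
      ∀ Q : ((W.baseChange K).baseChange E).toAffine.Point,
        ∃ R s : ((W.baseChange K).baseChange E).toAffine.Point, f Q - N • Q - ((2 : ℤ) ^ k) • R = s ∧ 2 • s = 0) :
    ∃ N₀ : ℕ, ∀ N : ℕ, N₀ ≤ N →
      (Affine.Point.baseChange (W' := W.baseChange K) K E).range ⊔
          (zsmulAddGroupHom ((2 ^ N : ℕ) : ℤ) : ((W.baseChange K).baseChange E).toAffine.Point →+ _).range =
        (AddSubgroup.zmultiples (Affine.Point.baseChange (W' := W.baseChange K) K E
              (Affine.Point.congrEquiv h₁ (Affine.Point.map (W' := W.toAffine) (Algebra.ofId ℚ K) P))) ⊔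
            AddSubgroup.torsionBy ((W.baseChange K).baseChange E).toAffine.Point 2) ⊔
          (zsmulAddGroupHom ((2 ^ N : ℕ) : ℤ) : ((W.baseChange K).baseChange E).toAffine.Point →+ _).range := by
  haveI : Fact (Nat.Prime 2) := ⟨Nat.prime_two⟩
  have hj : W.j = -3375 := j_eq_of_smul_eq_cm7Twist hd0 W C hC
  obtain ⟨θ, hθ⟩ := exists_sq_eq_neg_seven_of_cmEndo_mem_endRing W K hj π hrel
  -- (1) `7 • E(K) ⊆ ℤ P_K + ℤ P₁ + tors`
  obtain ⟨P₁, hP₁, hseven⟩ := seven_smul_mem_of_frame W K hK π hrel hP hgen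
  -- (2) no `K`-rational point of order `4`
  have h4 : ∀ x : (W.baseChange K).toAffine.Point, 4 • x = 0 → 2 • x = 0 :=
    fun x hx ↦ two_nsmul_eq_zero_of_four_nsmul_eq_zero_of_frame hd0 hsq hd4 W C hC hK v vbar hv hvbar hne π hrel hr hpin x hx
  -- (4) `G[2] ⊆ im E(K)`
  obtain ⟨hG2, -⟩ := torsionBy_two_le_range_and_natCard_eq_four_of_cmEndo W hj hθ π hrel hr E h₁
  obtain ⟨k₀, hk₀⟩ := hdisc
  refine ⟨k₀, fun N hN ↦ ?_⟩
  -- the map `E(K) → G`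
  set f' : (W.baseChange K).toAffine.Point →+ ((W.baseChange K).baseChange E).toAffine.Point :=
    (Affine.Point.baseChange (W' := W.baseChange K) K E).comp (Affine.Point.congrEquiv h₁).toAddMonoidHom with hf'
  have hf'apply : ∀ Q, f' Q = Affine.Point.baseChange (W' := W.baseChange K) K E (Affine.Point.congrEquiv h₁ Q) := fun _ ↦ rfl
  have hrange : f'.range = (Affine.Point.baseChange (W' := W.baseChange K) K E).range := by
    ext x
    constructor
    · rintro ⟨Q, rfl⟩; exact ⟨_, rfl⟩
    · rintro ⟨Q', rfl⟩
      exact ⟨(Affine.Point.congrEquiv h₁).symm Q', by rw [hf'apply, AddEquiv.apply_symm_apply]⟩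
  -- (3) the discrepancy at level `N`
  obtain ⟨Nsc, hNsc⟩ := exists_int_sub_mem_span (p := 2) (1 - r) N
  obtain ⟨R, s, hRs, hs⟩ := hk₀ N hN Nsc hNsc (f' (Affine.Point.map (W' := W.toAffine) (Algebra.ofId ℚ K) P))
  have hdisc' : ∃ (c : ℤ) (R s : ((W.baseChange K).baseChange E).toAffine.Point),
      f' P₁ = c • f' (Affine.Point.map (W' := W.toAffine) (Algebra.ofId ℚ K) P) + ((2 ^ N : ℕ) : ℤ) • R + s ∧ 2 • s = 0 := by
    refine ⟨Nsc, R, s, ?_, hs⟩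
    rw [hf'apply P₁, ← pointHom_baseChange_congrEquiv_eq W E h₁ π φ hφ f hf hP₁, ← hf'apply, ← hRs]
    push_cast
    abel
  have key := range_sup_range_eq_of_inputs f' (Affine.Point.map (W' := W.toAffine) (Algebra.ofId ℚ K) P) P₁ N hseven h4 hdisc'
    (hrange ▸ hG2)
  rw [hrange] at key
  exact key

/-! ## §4. On the S3c frame at `E = K_v`: the combination, `#E(K_v)[2] = 4`, and (PI) VERBATIM -/

/-- `W_K = (W_K) ⊗_K K` (-w2 g11's `h₁`; Mathlib `WeierstrassCurve.map_baseChange`). [folklore] -/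
theorem baseChange_eq_baseChange_baseChange_self (W : WeierstrassCurve ℚ) : W.baseChange K = (W.baseChange K).baseChange K :=
  ((W.baseChange K).map_baseChange (Algebra.ofId K K)).symm

/-- `W_E = (W_K) ⊗_K E` for a `K`-field `E` (-w2 g11's `h₂`; `map_map` and the uniqueness of `ℚ → E`). [folklore] -/
theorem baseChange_eq_baseChange_baseChange (W : WeierstrassCurve ℚ) (E : Type) [Field E] [Algebra K E] [Algebra ℚ E] :
    W.baseChange E = (W.baseChange K).baseChange E := by
  change W.map (algebraMap ℚ E) = (W.map (algebraMap ℚ K)).map (algebraMap K E)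
  rw [WeierstrassCurve.map_map, Subsingleton.elim ((algebraMap K E).comp (algebraMap ℚ K)) (algebraMap ℚ E)]

/-- **THE `𝒪_K`-COMBINATION AT `v` ON EVERY S3c FRAME** (LEAD cf2-p1 g13 ASSIGN 2026-08-28T23:58:11Z): with `G := ((W_K) ⊗ K_v)(K_v)` and
`P_v` the ℚ-generator read in `K_v`, for all large `N`:
**`im(E(K) → G) + 2^N G = (ℤ·P_v + G[2]) + 2^N G`.** §3 with the discrepancy DISCHARGED by -w3 g10's `cmScalar_pointHom_two_torsion_of_frame`
(for the isogeny of `CMPrimes.exists_isogeny_apply_eq_cmEndo` and its descent `exists_pointHom_localPointsMap`).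
[cite: Rubin1999, §2–§3, Lemma 3.6 (ii)] [cite: Agboola2007, §6 Props. 6.10–6.11] [cite: SilvermanAEC2009, Prop. VII.6.3, VIII §1] -/
theorem range_baseChange_sup_range_eq_of_frame {d : ℤ} (hd0 : d ≠ 0) (hsq : Squarefree d) (hd4 : d % 4 ≠ 1)
    (W : WeierstrassCurve ℚ) [W.IsElliptic] (C : VariableChange ℚ) (hC : C • W = cm7.quadraticTwist (d : ℚ)) (hK : IsImaginaryQuadratic K)
    (v vbar : HeightOneSpectrum (𝓞 K)) (hv : ((2 : ℕ) : 𝓞 K) ∈ v.asIdeal) (hvbar : ((2 : ℕ) : 𝓞 K) ∈ vbar.asIdeal) (hne : vbar ≠ v)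
    (π : (W.baseChange K).endRing) (hrel : (π : AddMonoid.End (W.baseChange K).geomPoints) * π = π - 2) {r : ℤ_[2]} (hr : r * r = r - 2)
    (hpin : ∀ τ ∈ GreenbergSelmer.inertia v, ∀ x : ↥((W.baseChange K).endEigenPrimaryTorsion 2 π r), τ • x = x ∨ τ • x = -x)
    (P : W.toAffine.Point) (hP : ¬ IsOfFinAddOrder P)
    (hgen : ∀ R : W.toAffine.Point, ∃ (k : ℤ) (T : W.toAffine.Point), IsOfFinAddOrder T ∧ R = k • P + T)
    (hfin : Finite (restrictedSelmerBase ↥((W.baseChange K).endEigenPrimaryTorsion 2 π r) 2 vbar))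
    (h₁ : W.baseChange K = (W.baseChange K).baseChange K) :
    ∃ N₀ : ℕ, ∀ N : ℕ, N₀ ≤ N →
      (Affine.Point.baseChange (W' := W.baseChange K) K (v.adicCompletion K)).range ⊔
          (zsmulAddGroupHom ((2 ^ N : ℕ) : ℤ) : ((W.baseChange K).baseChange (v.adicCompletion K)).toAffine.Point →+ _).range =
        (AddSubgroup.zmultiples (Affine.Point.baseChange (W' := W.baseChange K) K (v.adicCompletion K)
              (Affine.Point.congrEquiv h₁ (Affine.Point.map (W' := W.toAffine) (Algebra.ofId ℚ K) P))) ⊔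
            AddSubgroup.torsionBy ((W.baseChange K).baseChange (v.adicCompletion K)).toAffine.Point 2) ⊔
          (zsmulAddGroupHom ((2 ^ N : ℕ) : ℤ) : ((W.baseChange K).baseChange (v.adicCompletion K)).toAffine.Point →+ _).range := by
  haveI : Fact (Nat.Prime 2) := ⟨Nat.prime_two⟩
  haveI : CharZero (v.adicCompletion K) := charZero_of_injective_algebraMap (algebraMap K (v.adicCompletion K)).injective
  -- the isogeny realising `π` and its descent to `E(K_v)`
  have hπ : (π : AddMonoid.End (W.baseChange K).geomPoints) ∈ (W.baseChange K).geomEndRing := (Subring.mem_inf.1 π.2).1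
  have hequiv := ((W.baseChange K).mem_equivariantSubring_iff (π : AddMonoid.End (W.baseChange K).geomPoints)).1
    (Subring.mem_inf.1 π.2).2
  obtain ⟨φ, hφ, -⟩ := CMPrimes.exists_isogeny_apply_eq_cmEndo (W.baseChange K) hπ hequiv hrel
  obtain ⟨f, hf⟩ := exists_pointHom_localPointsMap (W.baseChange K) (v.adicCompletion K) φ
  -- the 2-torsion discrepancy (-w3 g10)
  obtain ⟨k₀, hk₀⟩ := cmScalar_pointHom_two_torsion_of_frame hd0 hsq hd4 W C hC hK v vbar hv hvbar hne π hrel hr hpin P hP hfin φ hφ f hf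
  refine range_baseChange_sup_range_eq_of_discrepancy hd0 hsq hd4 W C hC hK v vbar hv hvbar hne π hrel hr hpin hP hgen
    (v.adicCompletion K) h₁ φ hφ f hf ⟨k₀, fun k hk N hN Q ↦ ?_⟩
  obtain ⟨R, T, hT2, hRT⟩ := hk₀ k hk N hN Q
  refine ⟨R, _, hRT, ?_⟩
  have h := congrArg (Affine.Point.baseChange (W' := W.baseChange K) K (v.adicCompletion K)) hT2
  exact ((map_nsmul _ 2 _).symm.trans h).trans (map_zero _)

/-- **`#E(K_v)[2] = 4` and `E(K_v)[2] ⊆ im E(K)` ON EVERY S3c FRAME** — the `C_t := G[2]` datum of -w2 g11's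
`LocalLineCount.index_zmultiples_baseChange_sup_sup_range_eq` (2-power torsion by `exists_two_pow_nsmul_eq_zero_of_mem_torsionBy_two`).
[cite: SilvermanAEC2009, Cor. III.6.4, VIII §1] [cite: Rubin1999, §2] -/
theorem natCard_torsionBy_two_eq_four_of_frame {d : ℤ} (hd0 : d ≠ 0) (W : WeierstrassCurve ℚ) [W.IsElliptic] (C : VariableChange ℚ)
    (hC : C • W = cm7.quadraticTwist (d : ℚ)) (π : (W.baseChange K).endRing)
    (hrel : (π : AddMonoid.End (W.baseChange K).geomPoints) * π = π - 2) {r : ℤ_[2]} (hr : r * r = r - 2)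
    (E : Type) [Field E] [Algebra K E] :
    AddSubgroup.torsionBy ((W.baseChange K).baseChange E).toAffine.Point 2 ≤ (Affine.Point.baseChange (W' := W.baseChange K) K E).range ∧
      Nat.card (AddSubgroup.torsionBy ((W.baseChange K).baseChange E).toAffine.Point 2) = 4 := by
  have hj : W.j = -3375 := j_eq_of_smul_eq_cm7Twist hd0 W C hC
  obtain ⟨θ, hθ⟩ := exists_sq_eq_neg_seven_of_cmEndo_mem_endRing W K hj π hrel
  exact torsionBy_two_le_range_and_natCard_eq_four_of_cmEndo W hj hθ π hrel hr E (baseChange_eq_baseChange_baseChange_self W)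

/-- **(PI) OF THE PLAIN ROAD, VERBATIM** (hypothesis `hPI` of -w8 g3's `SelmerLocImage.hcounts_of_pointIndex_of_pinning_of_finiteSha`): on every S3c
frame there is `N₃` with **`v₂ [E(K_v) : im E(K) + 2^N E(K_v)] = ℓ`** for all `N ≥ N₃` (`e₃ ≡ 0`). Assembly: `range_baseChange_sup_range_eq_of_frame`
(this file) rewrites the subgroup as `ℤ·P_v + E(K_v)[2] + 2^N E(K_v)`, whose index is `2^{ℓ}` by -w2 g11's
`LocalLineCount.index_zmultiples_baseChange_sup_sup_range_eq` (p680004) with `C_t := E(K_v)[2]` (`natCard_torsionBy_two_eq_four_of_frame`);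
`K_v ≅ ℚ₂` by -w6 g3's `exists_surjective_padic_adicCompletion`; `ℓ ≥ 0` by -w2's `DyadicTorsion.le_ell_of_smul_eq_quadraticTwist`.
[cite: SilvermanAEC2009, Prop. VII.6.3] [cite: Agboola2007, §6 Props. 6.10–6.11] [cite: Rubin1999, §3 Lemma 3.6 (ii)] -/
theorem hPI_holds :
    ∃ e₃ : ℤ → ℤ → ℤ, ∀ (d : ℤ), d ≠ 0 → Squarefree d → d % 4 ≠ 1 →
      ∀ (W : WeierstrassCurve ℚ) [W.IsElliptic] [W.IsGloballyMinimal] (C : WeierstrassCurve.VariableChange ℚ),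
        C • W = cm7.quadraticTwist (d : ℚ) → W.analyticRank = 1 →
      ∀ (K : Type) [Field K] [NumberField K], IsImaginaryQuadratic K →
      ∀ (v vbar : HeightOneSpectrum (𝓞 K)),
        ((2 : ℕ) : 𝓞 K) ∈ v.asIdeal → ((2 : ℕ) : 𝓞 K) ∈ vbar.asIdeal → vbar ≠ v →
      ∀ (π : (W.baseChange K).endRing), (π : AddMonoid.End (W.baseChange K).geomPoints) * π = π - 2 →
      ∀ (r : ℤ_[2]), r * r = r - 2 →
        (∀ τ ∈ GreenbergSelmer.inertia v, ∀ x : ↥((W.baseChange K).endEigenPrimaryTorsion 2 π r), τ • x = x ∨ τ • x = -x) →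
      ∀ (P : W.toAffine.Point) (c₀ : ℕ) (ℓ : ℤ),
        ¬ IsOfFinAddOrder P →
        (∀ R : W.toAffine.Point, ∃ (k : ℤ) (T : W.toAffine.Point), IsOfFinAddOrder T ∧ R = k • P + T) →
        c₀ ≠ 0 → (W.baseChange ℚ_[2]).IsInReductionKernel (c₀ • W.toPadicPoint 2 P) →
        ‖(W.baseChange ℚ_[2]).padicLogPoint (c₀ • W.toPadicPoint 2 P) / (c₀ : ℚ_[2])‖ = (2 : ℝ) ^ (-ℓ) →
      Finite (restrictedSelmerBase ↥((W.baseChange K).endEigenPrimaryTorsion 2 π r) 2 vbar) →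
      ∃ N₃ : ℕ, ∀ N : ℕ, N₃ ≤ N →
        (padicValNat 2 (((Affine.Point.baseChange (W' := W.baseChange K) K (v.adicCompletion K)).range ⊔
          (zsmulAddGroupHom ((2 ^ N : ℕ) : ℤ) : ((W.baseChange K).baseChange (v.adicCompletion K)).toAffine.Point →+ _).range).index) : ℤ) =
          ℓ + e₃ (d % 2) ((d / (2 - d % 2)) % 8) := by
  refine ⟨fun _ _ ↦ 0, ?_⟩
  intro d hd0 hsq hd4 W _ _ C hC _ K _ _ hK v vbar hv hvbar hne π hrel r hr hpin P c₀ ℓ hP hgen hc₀ hker hlog hfin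
  haveI : Fact (Nat.Prime 2) := ⟨Nat.prime_two⟩
  haveI : CharZero (v.adicCompletion K) := charZero_of_injective_algebraMap (algebraMap K (v.adicCompletion K)).injective
  have h₁ : W.baseChange K = (W.baseChange K).baseChange K := baseChange_eq_baseChange_baseChange_self W
  have h₂ : W.baseChange (v.adicCompletion K) = (W.baseChange K).baseChange (v.adicCompletion K) :=
    baseChange_eq_baseChange_baseChange W (v.adicCompletion K)
  -- the combination, the torsion datum, `K_v ≅ ℚ₂`, and the index core
  obtain ⟨N₀, hN₀⟩ := range_baseChange_sup_range_eq_of_frame hd0 hsq hd4 W C hC hK v vbar hv hvbar hne π hrel hr hpin P hP hgen hfin h₁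
  obtain ⟨hle, hcard⟩ := natCard_torsionBy_two_eq_four_of_frame hd0 W C hC π hrel hr (v.adicCompletion K)
  obtain ⟨φ, hφ⟩ := exists_surjective_padic_adicCompletion hK.1 hvbar hv hne.symm
  obtain ⟨N₁, hN₁⟩ := LocalLineCount.index_zmultiples_baseChange_sup_sup_range_eq hd0 hsq hd4 W hC K (v.adicCompletion K) φ hφ h₁ h₂
    hc₀ hker hlog
  have hℓ : 0 ≤ ℓ := le_trans (by split_ifs <;> norm_num)
    (DyadicTorsion.le_ell_of_smul_eq_quadraticTwist d hd0 hsq hd4 W C hC P c₀ ℓ hc₀ hker hlog)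
  refine ⟨max N₀ N₁, fun N hN ↦ ?_⟩
  rw [hN₀ N (le_trans (le_max_left _ _) hN), hN₁ N (le_trans (le_max_right _ _) hN) _
    (fun c hc ↦ exists_two_pow_nsmul_eq_zero_of_mem_torsionBy_two c hc) hcard, padicValNat.prime_pow, add_zero]
  exact Int.toNat_of_nonneg hℓ

end Frame

end Summit.BirchSwinnertonDyer.BirchSwinnertonDyer.Theorems.PrintCf2.LocalPointImage

end
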